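import Mathlib
import Summits.KontsevichZagierPeriods.Zeta5Search.Profile18aCellsA
import Summits.KontsevichZagierPeriods.Zeta5Search.Profile18aCellsB
import Summits.KontsevichZagierPeriods.Zeta5Search.DenomLaw.Profile18bPath
import Summits.KontsevichZagierPeriods.Zeta5Search.DenomLaw.ZeroPointCoverKit
import Summits.KontsevichZagierPeriods.Zeta5Search.ClassTypeGuardsI
import HarnessLib

/-!
# ζ(5) search — the `N_p = 18` PROFILE with short blocks `(1,2), (1,3), (1,4)` for EVERY sorted parameter vector: THEOREM A‴ `−10` in the frame `(8, [1,−5,−5,1])` and the ZERO-POINT law `−9` at `3p ≤ d` ⇒ PATH accounting on the whole profile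

Cell `pub-zeta5` (HONEST FRAMING: systematic search; no irrationality claim unless certified), TRACK «DENOM-LAW» D1 prover seat
(denom-prover-d1 g18, `HOME/denom-law/prover-d1/ATTEMPT-18.md` §2).  Fifth general-`b` profile of the first period after `DenomLaw/FullProfilePath`
(`N_p = 21`), `DenomLaw/Profile20Path`, `DenomLaw/Profile19Path` and `DenomLaw/Profile18bPath` (gen 17).  At `N_p = 18` the third short block of a sorted
vector is `b₀ − b₁ − b₄` or `b₀ − b₂ − b₃`; this file treats the FORMER branch — `p ≤ b₇`, `b₀ − b₁ − b₄ < p ≤ min(b₀ − b₁ − b₅, b₀ − b₂ − b₃)` inside the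
first period — which gen 17 left open («1,495 of 3,449 instances need uncatalogued rungs», ATTEMPT-17 §4).  Gen 18's GLOBAL CENSUS (ATTEMPT-18 §1: every
landed law of the tree read at type level, validated against 114,713 exact valuations) shows that two LANDED laws close it: on the machine-generated covers
`FullProfile.cover18a_ev / cover18a_od` (`Profile18aCells{A,B}`, 28 / 27 types; least multipole exponent `−8`, realised only by the centre-free palindrome
`[1,−5,−5,1]`; its single raises `[1,−4,−5,1]`, `[1,−5,−4,1]` and its odd-centre copy are the only classes of exponent `−7`; every single-pole class is tame
with `ν ≥ 0` or has `ν ≥ −6`)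
* THEOREM A‴ (`SecondOrder.lawA3_holds`, through `ClusterValuation.lawA3_of_cover` / `checkI`) in the frame `(M, T) = (8, [1,−5,−5,1])` gives
  **`v_p(Cas_j(b)) ≥ 6 − 2M = −10` on the whole profile** (`cas_ge18a_neg10`, every `j`) — the node's value `⌊d/p⌋ − 12` for `⌊d/p⌋ ≤ 2`;
* at `3p ≤ d` (DEG `6p ≤ 2d + 1`) the live classes form the ONE-POINT zero window `(8; D8 = [[1,−5,−5,1]], S = [])`, so the ZERO-POINT type-space law
  (`ResidueLaw.typeSpaceLawZeroPoint_holds` via `DenomLaw.zeroPoint_ZP8D`) gives **`7 − 2M = −9`** (`cas_ge18a_neg9`) — the node's value at `⌊d/p⌋ = 3`.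
With `N_p = 18` (`pairFloors_eq_18a`), `C⋆ ≤ 11` and `p < d < 4p` (`d_bounds18a`): **`pathAccounting_profile18a`** (every `j`) and
**`pathAccountingFirstPeriod_profile18a`** (the node `DenomLaw.PathAccountingFirstPeriod` with its binders VERBATIM plus the four profile inequalities), and
(CV) on the whole profile (`profile18aCV`).  Census beside the proof (`g18/code/profile_census.py`, exhaustive `p ≤ 11`, 3,449 instances): A‴ reaches the node
on all 3,303 cells with `⌊d/p⌋ ≤ 2`, the zero-point structure holds on all 146 cells with `⌊d/p⌋ = 3`; exact `v = node` at every sampled cell.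
MODEL/structure-side valuation bookkeeping of the cell's own rationals; nothing about ζ(5); no γ; records in print UNMOVED.
-/

open Finset

namespace Summit.KontsevichZagierPeriods.Zeta5Search.FullProfile

open Summit.KontsevichZagierPeriods.Zeta5Search.ClusterValuation
open Summit.KontsevichZagierPeriods.Zeta5Search.CasoratianValuation (InPolytope shift casoratian pairFloors refund)
open Summit.KontsevichZagierPeriods.Zeta5Search.WedgeDictionary (dOf)
open Summit.KontsevichZagierPeriods.Zeta5Search.ClassTypeCover
open Summit.KontsevichZagierPeriods.Zeta5Search.DenomLaw (cStar FirstPeriod Sorted7 zeroClasses_of_cover zeroPoint_ZP8D)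
open Summit.KontsevichZagierPeriods.Zeta5Search.ZeroWindows (ZeroWindowClasses)
open Summit.KontsevichZagierPeriods.Zeta5Search.DenomLaw.FirstPeriodKit (cStar_le_eleven sorted7_chain firstPeriod_pair pairFloors_expand)
open Summit.KontsevichZagierPeriods.Zeta5Search.StairTS3 (refund_le_pathHead)
open Summit.KontsevichZagierPeriods.Zeta5Search.SortedProfile

/-! ## §1 The profile: `p < d < 4p` and `N_p = 18` -/

section Bounds

variable {b : ℕ → ℤ} {j p : ℕ}

/-- On this profile `p < d(b) < 4p` (`d + b₄ = (b₀−b₁−b₇) + (b₀−b₂−b₆) + (b₀−b₃−b₅) ≥ 3p` with `b₄ ≤ b₁ < 2p`; `3b₀ < 3p + 3b₁ + 3b₄`). -/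
theorem d_bounds18a (hs : Sorted7 b) (hP : (p : ℤ) ≤ b 7) (hQ : b 0 < (p : ℤ) + b 1 + b 4) (hQ5 : (p : ℤ) + b 1 + b 5 ≤ b 0)
    (hQ23 : (p : ℤ) + b 2 + b 3 ≤ b 0) (hF1 : b 1 < 2 * (p : ℤ)) :
    (p : ℤ) < dOf b ∧ dOf b < 4 * (p : ℤ) := by
  obtain ⟨h21, h32, h43, h54, h65, h76⟩ := sorted7_chain hs
  rw [DecompositionWholeCone.dOf_expand]; constructor <;> linarith

/-- **`N_p = 18`** on this profile: the pair digits of `(1,2), (1,3), (1,4)` are `0`, the other eighteen are `1`. -/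
theorem pairFloors_eq_18a (hb : InPolytope b) (hs : Sorted7 b) (hp : 0 < p) (hQ : b 0 < (p : ℤ) + b 1 + b 4) (hQ5 : (p : ℤ) + b 1 + b 5 ≤ b 0)
    (hQ23 : (p : ℤ) + b 2 + b 3 ≤ b 0) (hfp : FirstPeriod b p) : pairFloors b p = 18 := by
  obtain ⟨h21, h32, h43, h54, h65, h76⟩ := sorted7_chain hs
  obtain ⟨h0, hb1, hb2, hb3, hb4, -, -, -, hc1⟩ := box hb
  have hp0 : (0 : ℤ) < p := by exact_mod_cast hp
  have one : ∀ z : ℤ, (p : ℤ) ≤ z → z ≤ 2 * (p : ℤ) - 1 → z / (p : ℤ) = 1 := fun z h1 h2 => by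
    rw [Int.ediv_eq_iff_of_pos hp0]; constructor <;> linarith
  have z12 : (b 0 - b 1 - b 2) / (p : ℤ) = 0 := Int.ediv_eq_zero_of_lt (by linarith) (by linarith)
  have z13 : (b 0 - b 1 - b 3) / (p : ℤ) = 0 := Int.ediv_eq_zero_of_lt (by linarith) (by linarith)
  have z14 : (b 0 - b 1 - b 4) / (p : ℤ) = 0 := Int.ediv_eq_zero_of_lt (by linarith) (by linarith)
  have U := fun (i k : ℕ) (hi : i < 7) (hk : k < 7) (hik : i < k) => firstPeriod_pair hfp hi hk hik
  rw [pairFloors_expand, z12, z13, z14,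
    one _ (by linarith) (U 0 4 (by norm_num) (by norm_num) (by norm_num)), one _ (by linarith) (U 0 5 (by norm_num) (by norm_num) (by norm_num)),
    one _ (by linarith) (U 0 6 (by norm_num) (by norm_num) (by norm_num)),
    one _ (by linarith) (U 1 2 (by norm_num) (by norm_num) (by norm_num)), one _ (by linarith) (U 1 3 (by norm_num) (by norm_num) (by norm_num)),
    one _ (by linarith) (U 1 4 (by norm_num) (by norm_num) (by norm_num)), one _ (by linarith) (U 1 5 (by norm_num) (by norm_num) (by norm_num)),
    one _ (by linarith) (U 1 6 (by norm_num) (by norm_num) (by norm_num)),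
    one _ (by linarith) (U 2 3 (by norm_num) (by norm_num) (by norm_num)), one _ (by linarith) (U 2 4 (by norm_num) (by norm_num) (by norm_num)),
    one _ (by linarith) (U 2 5 (by norm_num) (by norm_num) (by norm_num)), one _ (by linarith) (U 2 6 (by norm_num) (by norm_num) (by norm_num)),
    one _ (by linarith) (U 3 4 (by norm_num) (by norm_num) (by norm_num)), one _ (by linarith) (U 3 5 (by norm_num) (by norm_num) (by norm_num)),
    one _ (by linarith) (U 3 6 (by norm_num) (by norm_num) (by norm_num)), one _ (by linarith) (U 4 5 (by norm_num) (by norm_num) (by norm_num)),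
    one _ (by linarith) (U 4 6 (by norm_num) (by norm_num) (by norm_num)), one _ (by linarith) (U 5 6 (by norm_num) (by norm_num) (by norm_num))]
  norm_num

/-! ## §2 The two bounds on the profile, every sorted `b`, every `j` -/

/-- **THEOREM A‴ on this profile, general `b`**: `v_p(Cas_j(b)) ≥ −10 = 6 − 2M` in the frame `(8, [1,−5,−5,1])` for every sorted `b` in the polytope, every
admissible `j`, every first-period prime `p ≥ 5` with `b₀ + 2 < p²` on the profile (the four class clauses `checkI` hold on both covers: `decide`). -/
theorem cas_ge18a_neg10 (hb : InPolytope b) (hs : Sorted7 b) (hbj : InPolytope (shift b j)) (hj1 : 1 ≤ j) (hj7 : j ≤ 7)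
    (hprime : p.Prime) (hp5 : 5 ≤ p) (hwin : (b 0 + 2 : ℤ) < (p : ℤ) ^ 2) (hP : (p : ℤ) ≤ b 7) (hQ : b 0 < (p : ℤ) + b 1 + b 4)
    (hQ5 : (p : ℤ) + b 1 + b 5 ≤ b 0) (hQ23 : (p : ℤ) + b 2 + b 3 ≤ b 0) (hF1 : b 1 < 2 * (p : ℤ)) (hF2 : b 0 < 2 * (p : ℤ) + b 6 + b 7)
    (hcas : casoratian b j ≠ 0) : (-10 : ℤ) ≤ padicValRat p (casoratian b j) := by
  haveI : Fact p.Prime := ⟨hprime⟩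
  have hp2 : p % 2 = 1 := Nat.odd_iff.1 (hprime.odd_of_ne_two (by omega))
  obtain ⟨h0, hb1, hb2, hb3, hb4, -, -, -, -⟩ := box hb
  have hpb : (p : ℤ) ≤ b 0 := by linarith
  have hT : ([1, -5, -5, 1] : List ℤ).reverse = [1, -5, -5, 1] := by decide
  rcases Int.emod_two_eq_zero_or_one (b 0) with hr | hr
  · have h := lawA3_of_cover hb hbj hj1 hj7 hprime hp5 hpb hwin (cover18a_ev hb hs hP hQ hQ5 hQ23 hF1 hF2 hp5 hp2 hr) (M := 8)
      (by norm_num) (by decide) hT (by rw [oddFlag_false hr]; decide) hcas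
    simpa using h
  · have h := lawA3_of_cover hb hbj hj1 hj7 hprime hp5 hpb hwin (cover18a_od hb hs hP hQ hQ5 hQ23 hF1 hF2 hp5 hp2 hr) (M := 8)
      (by norm_num) (by decide) hT (by rw [oddFlag_true hr]; decide) hcas
    simpa using h

/-- **The ZERO-POINT law on this profile at `3p ≤ d`, general `b`**: `v_p(Cas_j(b)) ≥ −9 = 7 − 2M` — the live classes at `M = 8` are the deep palindrome
`[1,−5,−5,1]`, its two single raises and its odd-centre copy: ONE orbit point (`DenomLaw.zeroPoint_ZP8D`). -/
theorem cas_ge18a_neg9 (hb : InPolytope b) (hs : Sorted7 b) (hbj : InPolytope (shift b j)) (hj1 : 1 ≤ j) (hj7 : j ≤ 7)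
    (hprime : p.Prime) (hp5 : 5 ≤ p) (hwin : (b 0 + 2 : ℤ) < (p : ℤ) ^ 2) (hP : (p : ℤ) ≤ b 7) (hQ : b 0 < (p : ℤ) + b 1 + b 4)
    (hQ5 : (p : ℤ) + b 1 + b 5 ≤ b 0) (hQ23 : (p : ℤ) + b 2 + b 3 ≤ b 0) (hF1 : b 1 < 2 * (p : ℤ)) (hF2 : b 0 < 2 * (p : ℤ) + b 6 + b 7)
    (hd : 3 * (p : ℤ) ≤ dOf b) (hcas : casoratian b j ≠ 0) : (-9 : ℤ) ≤ padicValRat p (casoratian b j) := by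
  haveI : Fact p.Prime := ⟨hprime⟩
  have hp2 : p % 2 = 1 := Nat.odd_iff.1 (hprime.odd_of_ne_two (by omega))
  obtain ⟨h0, hb1, hb2, hb3, hb4, -, -, -, -⟩ := box hb
  have hpb : (p : ℤ) ≤ b 0 := by linarith
  have hdeg : (p : ℤ) * 6 ≤ 2 * dOf b + 1 := by linarith
  have hC : ZeroWindowClasses b p 8 ZeroWindows.D8 [] := by
    rcases Int.emod_two_eq_zero_or_one (b 0) with hr | hr
    · exact zeroClasses_of_cover h0 (cover18a_ev hb hs hP hQ hQ5 hQ23 hF1 hF2 hp5 hp2 hr) (by rw [oddFlag_false hr]; decide)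
    · exact zeroClasses_of_cover h0 (cover18a_od hb hs hP hQ hQ5 hQ23 hF1 hF2 hp5 hp2 hr) (by rw [oddFlag_true hr]; decide)
  exact zeroPoint_ZP8D hb hbj hj1 hj7 hprime hp5 hpb hwin hC hdeg hcas

end Bounds

/-! ## §3 PATH accounting and (CV) on the whole profile -/

/-- **`PathAccountingFirstPeriod`'s conclusion on this `N_p = 18` profile (short blocks `(1,2), (1,3), (1,4)`), EVERY sorted `b`, every direction `j`**:
`b` sorted in the polytope with `b + e_j` in the polytope, a first-period prime `p ≥ 5` with `b₀ + 2 < p²`, all seven parameters reaching `p` and exactly the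
pair blocks `b₀−b₁−b₂, b₀−b₁−b₃, b₀−b₁−b₄` short of `p`: `⌊d/p⌋ − N_p − min([⌊d/p⌋ ≥ 2], 5 − C⋆) ≤ v_p(Cas_j(b))`. -/
theorem pathAccounting_profile18a (b : ℕ → ℤ) (j p : ℕ) (hb : InPolytope b) (hs : Sorted7 b) (hbj : InPolytope (shift b j))
    (hj1 : 1 ≤ j) (hj7 : j ≤ 7) (hprime : p.Prime) (hp5 : 5 ≤ p) (hwin : (b 0 + 2 : ℤ) < (p : ℤ) ^ 2) (hfp : FirstPeriod b p)
    (hP : (p : ℤ) ≤ b 7) (hQ : b 0 < (p : ℤ) + b 1 + b 4) (hQ5 : (p : ℤ) + b 1 + b 5 ≤ b 0) (hQ23 : (p : ℤ) + b 2 + b 3 ≤ b 0)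
    (hcas : casoratian b j ≠ 0) :
    dOf b / (p : ℤ) - pairFloors b p - min (if 2 ≤ dOf b / (p : ℤ) then (1 : ℤ) else 0) (5 - (cStar b p : ℤ))
      ≤ padicValRat p (casoratian b j) := by
  obtain ⟨hF1, hF2⟩ := fp_bounds hfp
  have hp0 : (0 : ℤ) < p := by exact_mod_cast hprime.pos
  rw [pairFloors_eq_18a hb hs hprime.pos hQ hQ5 hQ23 hfp]
  have hC11 : (cStar b p : ℤ) ≤ 11 := by exact_mod_cast cStar_le_eleven b p
  have hmin : -6 ≤ min (if 2 ≤ dOf b / (p : ℤ) then (1 : ℤ) else 0) (5 - (cStar b p : ℤ)) :=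
    le_min (by split_ifs <;> norm_num) (by linarith)
  obtain ⟨-, hd4⟩ := d_bounds18a hs hP hQ hQ5 hQ23 hF1
  by_cases h3 : 3 * (p : ℤ) ≤ dOf b
  · have hfd : dOf b / (p : ℤ) < 4 := by rw [Int.ediv_lt_iff_lt_mul hp0]; linarith
    linarith [cas_ge18a_neg9 hb hs hbj hj1 hj7 hprime hp5 hwin hP hQ hQ5 hQ23 hF1 hF2 h3 hcas]
  · push Not at h3
    have hfd : dOf b / (p : ℤ) < 3 := by rw [Int.ediv_lt_iff_lt_mul hp0]; linarith
    linarith [cas_ge18a_neg10 hb hs hbj hj1 hj7 hprime hp5 hwin hP hQ hQ5 hQ23 hF1 hF2 hcas]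

/-- **THE NODE ON THIS `N_p = 18` PROFILE, EVERY SORTED `b`: `PathAccountingFirstPeriod` with its binders VERBATIM plus `p ≤ b₇`, `b₀ < p + b₁ + b₄`,
`p + b₁ + b₅ ≤ b₀`, `p + b₂ + b₃ ≤ b₀`** (all parameters and exactly the eighteen pair blocks other than `(1,2), (1,3), (1,4)` reach `p`). -/
theorem pathAccountingFirstPeriod_profile18a :
    ∀ (b : ℕ → ℤ) (p : ℕ), InPolytope b → Sorted7 b → InPolytope (shift b 7) →
      p.Prime → 5 ≤ p → (b 0 + 2 : ℤ) < (p : ℤ) ^ 2 → FirstPeriod b p →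
      (p : ℤ) ≤ b 7 → b 0 < (p : ℤ) + b 1 + b 4 → (p : ℤ) + b 1 + b 5 ≤ b 0 → (p : ℤ) + b 2 + b 3 ≤ b 0 → casoratian b 7 ≠ 0 →
        dOf b / (p : ℤ) - pairFloors b p - min (if 2 ≤ dOf b / (p : ℤ) then (1 : ℤ) else 0) (5 - (cStar b p : ℤ))
          ≤ padicValRat p (casoratian b 7) :=
  fun b p hb hs hb7 hprime hp5 hwin hfp hP hQ hQ5 hQ23 hcas =>
    pathAccounting_profile18a b 7 p hb hs hb7 (by norm_num) (by norm_num) hprime hp5 hwin hfp hP hQ hQ5 hQ23 hcas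

/-- **(CV) on the whole profile, every sorted `b`, every `j`** (`refund − N_p ≤ −17 ≤ −10`). -/
theorem profile18aCV (b : ℕ → ℤ) (j p : ℕ) (hb : InPolytope b) (hs : Sorted7 b) (hbj : InPolytope (shift b j))
    (hj1 : 1 ≤ j) (hj7 : j ≤ 7) (hprime : p.Prime) (hp5 : 5 ≤ p) (hwin : (b 0 + 2 : ℤ) < (p : ℤ) ^ 2) (hfp : FirstPeriod b p)
    (hP : (p : ℤ) ≤ b 7) (hQ : b 0 < (p : ℤ) + b 1 + b 4) (hQ5 : (p : ℤ) + b 1 + b 5 ≤ b 0) (hQ23 : (p : ℤ) + b 2 + b 3 ≤ b 0)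
    (hcas : casoratian b j ≠ 0) : refund b p - pairFloors b p ≤ padicValRat p (casoratian b j) := by
  obtain ⟨hF1, hF2⟩ := fp_bounds hfp
  rw [pairFloors_eq_18a hb hs hprime.pos hQ hQ5 hQ23 hfp]
  have hr : refund b p ≤ 1 := min_le_left _ _
  linarith [cas_ge18a_neg10 hb hs hbj hj1 hj7 hprime hp5 hwin hP hQ hQ5 hQ23 hF1 hF2 hcas]

end Summit.KontsevichZagierPeriods.Zeta5Search.FullProfile
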